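import Summits.Ventures.YMGap.FlowData.RectTubeMassGapPrime
import Summits.Ventures.YMGap.FlowData.RectTubeCharacterLine
import Literature.Analysis.FunctionSpaces.BesselIIntegralSeries
import HarnessLib

/-!
# Venture YMGap, track Y3 FLOW-DATA — `SU(2)` rectangular tubes: the excited `e = 0` space is NOT annihilated and
# `m′ > 0` HYPOTHESIS-FREE at every `β > 0` (theorems only)

HONEST FRAMING: venture file of the cell `pub-ymgap` (QuantumFields programme), track Y3; companion THEOREMS for
`FlowData/RectTubeVacuumProjection.lean` (`su2RectMassGapPrime` = the FLOW-TABLE's `m′`, FLOW-PLAN O5).  Finite rectangular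
torus only; no number of the FLOW-TABLE, no row, nothing about `L → ∞`, the continuum, or a mass gap in the thermodynamic
sense.  `m′ > 0` here is Jentzsch's finite-volume gap made unconditional by exhibiting an excited trivial-flux state that the
transfer operator does not annihilate; the quantitative windows are in `RectTubeMassGapPrimeWindow` /
`RectTubeMassGapPrimeDivergence`.

THE WITNESSES.  `f₁ = e^{−J mag/2}` (the strong-coupling vacuum direction) and `f₂ = e^{−J mag/2}·U₂(a₀(hol_μ))`, the
ADJOINT character of the straight `μ`-line holonomy: both gauge invariant and twist invariant (`U₂` is even), hence in the
trivial-flux sector; `⟪f₁, T f₂⟫ = C₂ ∫ U₂(a₀(hol)) = 0`, `⟪f_i, T f_i⟫ = C_i ∫ W_i² > 0` (`RectTubeCharacterLine`), and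
`⟪Ω, f₁⟫ > 0`; the two-state bound of `RectTubeMassGapPrime` with `m = min` of the two Rayleigh quotients.

* `chebyshevU_two_su2a0_su2MinusOne_mul` — `U₂(a₀(−X)) = U₂(a₀(X))`;
* `integral_pos_of_ae_pos` — bookkeeping (`∫ f > 0` for an integrable a.e. positive `f` on a probability space);
* `su2_integral_exp_su2a0_eq`, `besselISub_two_div_three_zero` — `∫ e^{β a₀} = (I₀−I₂)(β)/1`, `(I₂−I₄)(0)/3 = 0`;
* **`su2_rectExcitedNorm_pos`** — `0 < su2RectExcitedNorm β Ls` (`β > 0`, given an axis `μ`);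
* **`su2RectMassGapPrime_pos`** — `0 < su2RectMassGapPrime β Ls` for every `β > 0` (with `RectTubeMassGapPrime.rectTubeExcitedNorm_lt_norm`).

References: M. Reed, B. Simon IV (1978) §XIII.12 [cite: ReedSimonIV1978, §XIII.12]; I. Montvay, G. Münster (1994) §3.2.6
[cite: MontvayMunster1994, §3.2.6]; G. Münster, Nucl. Phys. B 190 (1981) 439 (strong-coupling glueball / torelon scales)
[folklore].
-/

noncomputable section

open scoped BigOperators ENNReal
open MeasureTheory Filter Function Polynomial.Chebyshev
open Literature.MathematicalPhysics.QuantumFieldTheory Literature.Analysis.OperatorTheory Literature.Analysis.FunctionSpaces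
open Literature.MathematicalPhysics.QuantumLattice (RectTorusSite fundamentalRep continuous_fundamentalRep
  fundamentalRep_mem_unitaryGroup)
open Summit.Ventures.LatticeQCDFlow.Exactness Summit.Ventures.LatticeQCDFlow.Scoring

namespace Summit.Ventures.YMGap.FlowData

/-! ### Bookkeeping -/

section Bookkeeping

/-- **`U₂(a₀(−X)) = U₂(a₀(X))`**: the adjoint character is blind to the centre. [folklore] -/
theorem chebyshevU_two_su2a0_su2MinusOne_mul (X : Matrix.specialUnitaryGroup (Fin 2) ℂ) :
    (U ℝ ((2 : ℕ) : ℤ)).eval (su2a0 (su2MinusOne * X)) = (U ℝ ((2 : ℕ) : ℤ)).eval (su2a0 X) := by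
  have h1 : su2a0 (su2MinusOne * X) = -su2a0 X := by
    unfold su2a0
    rw [Submonoid.coe_mul, coe_su2MinusOne, neg_one_mul, Matrix.trace_neg, Complex.neg_re, neg_div]
  rw [h1]
  simp [U_two]

/-- On a probability space an integrable, a.e. strictly positive function has a strictly positive integral. [folklore] -/
theorem integral_pos_of_ae_pos {X : Type*} [MeasurableSpace X] {μ : Measure X} [IsProbabilityMeasure μ] {f : X → ℝ}
    (hf : Integrable f μ) (hpos : ∀ᵐ x ∂μ, 0 < f x) : 0 < ∫ x, f x ∂μ := by
  rw [integral_pos_iff_support_of_nonneg_ae (hpos.mono fun x hx => hx.le) hf]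
  have h1 : {x | 0 < f x} =ᵐ[μ] (Set.univ : Set X) := by
    rw [ae_eq_univ]
    rw [ae_iff] at hpos
    simpa only [Set.compl_setOf] using hpos
  have h2 : μ {x | 0 < f x} ≤ μ (Function.support f) :=
    measure_mono fun x (hx : 0 < f x) => (ne_of_gt hx : f x ≠ 0)
  have h3 : μ {x | 0 < f x} = 1 := by rw [measure_congr h1, measure_univ]
  rw [h3] at h2
  exact lt_of_lt_of_le one_pos h2

/-- `∫ e^{β a₀} dU = (I₀(β) − I₂(β))/1` (`β ≥ 0`; the one-step character rule at `n = 0`). [cite: MontvayMunster1994, §3.2.6] -/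
theorem su2_integral_exp_su2a0_eq {β : ℝ} (hβ : 0 ≤ β) :
    ∫ V, Real.exp (β * su2a0 V) ∂haarProbability (Matrix.specialUnitaryGroup (Fin 2) ℂ) =
      (besselI 0 β - besselI (0 + 2) β) / ((0 : ℕ) + 1) := by
  have h := su2_integral_exp_mul_chebyshevU_mul hβ 0 1
  simp only [Nat.cast_zero, U_zero, Polynomial.eval_one, mul_one] at h ⊢
  exact h

/-- `(I₂(0) − I₄(0))/3 = 0`: at `β = 0` only the trivial character survives. [cite: DLMF, 10.25.2] -/
theorem besselISub_two_div_three_zero : (besselI 2 0 - besselI (2 + 2) 0) / ((2 : ℕ) + 1 : ℝ) = 0 := by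
  rw [besselI_eq_latticeModels_besselI, besselI_eq_latticeModels_besselI,
    Literature.Probability.LatticeModels.besselI_zero_right, Literature.Probability.LatticeModels.besselI_zero_right]
  norm_num

end Bookkeeping

/-! ### The adjoint-line witness: the excited trivial-flux space is not annihilated -/

section SU2

variable {k : ℕ}

/-- **`0 < ‖T ∘ (P_0 − P_Ω)‖`** for the `SU(2)` tube at every `β > 0`, given an axis `μ` (`k ≥ 1`): the excited
trivial-flux space is not annihilated (two-state bound with the strong-coupling vacuum direction and the adjoint Polyakov
loop, `m = min` of the two Rayleigh quotients). [cite: MontvayMunster1994, §3.2.6] -/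
theorem su2_rectExcitedNorm_pos {β : ℝ} (hβ : 0 < β) (Ls : Fin k → ℕ) [∀ i, NeZero (Ls i)] (μ : Fin k) :
    0 < su2RectExcitedNorm β Ls := by
  haveI : SecondCountableTopology (Matrix.specialUnitaryGroup (Fin 2) ℂ) := secondCountableTopology_su2
  classical
  set ρ := fundamentalRep (Fin 2) with hρdef
  set J : ℝ := β / 2 with hJ
  set N : ℕ := Fintype.card (RectTorusSite Ls × Fin k) with hN
  set c0 : ℝ := (besselI 0 β - besselI (0 + 2) β) / ((0 : ℕ) + 1) with hc0
  set q2 : ℝ := (besselI 2 β - besselI (2 + 2) β) / ((2 : ℕ) + 1) with hq2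
  set C2 : ℝ := c0 ^ (N - Ls μ) * q2 ^ (Ls μ) with hC2
  -- the vacuum package
  obtain ⟨φ₀, h1, hpos, -, hinv, -, hvac, -⟩ := exists_rectVacuum_gap ρ J (Ls := Ls)
    (continuous_fundamentalRep (Fin 2)) fundamentalRep_mem_unitaryGroup su2MinusOne_mem_center
  -- the line, the two functions
  set ℓ : Fin (Ls μ) → RectTorusSite Ls × Fin k := fun t => (Pi.single μ ((t : ℕ) : ZMod (Ls μ)), μ) with hℓ
  set W2 : RectSlice Ls (Matrix.specialUnitaryGroup (Fin 2) ℂ) → ℝ :=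
    fun b => (U ℝ ((2 : ℕ) : ℤ)).eval (su2a0 ((List.ofFn fun t : Fin (Ls μ) => b (ℓ t)).prod)) with hW2
  set m0 : RectSlice Ls (Matrix.specialUnitaryGroup (Fin 2) ℂ) → ℝ :=
    fun b => Real.exp (-(J / 2 * rectMagSum (Ls := Ls) ρ b)) with hm0
  have hW2c : Continuous W2 :=
    (U ℝ ((2 : ℕ) : ℤ)).continuous.comp (continuous_su2a0.comp (continuous_prod_ofFn_apply (Ls μ) ℓ))
  have hIpos : ∀ n : ℕ, 0 < besselI n β := fun n => by
    rw [besselI_eq_latticeModels_besselI]; exact Literature.Probability.LatticeModels.besselI_pos hβ _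
  have hm0c : Continuous m0 :=
    Real.continuous_exp.comp (continuous_const.mul (continuous_rectMagSum (Ls := Ls) ρ (continuous_fundamentalRep (Fin 2)))).neg
  have hf1c : Continuous fun b => m0 b * (1 : ℝ) := hm0c.mul continuous_const
  have hf2c : Continuous fun b => m0 b * W2 b := hm0c.mul hW2c
  obtain ⟨K1, hK1⟩ := isCompact_univ.exists_bound_of_continuousOn hf1c.continuousOn
  obtain ⟨K2, hK2⟩ := isCompact_univ.exists_bound_of_continuousOn hf2c.continuousOn
  have hmem1 : MemLp (fun b => m0 b * (fun _ => (1 : ℝ)) b) 2 (rectSliceMeasure (Matrix.specialUnitaryGroup (Fin 2) ℂ) Ls) :=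
    MemLp.of_bound hf1c.aestronglyMeasurable K1 (Eventually.of_forall fun b => hK1 b (Set.mem_univ _))
  have hmem2 : MemLp (fun b => m0 b * W2 b) 2 (rectSliceMeasure (Matrix.specialUnitaryGroup (Fin 2) ℂ) Ls) :=
    MemLp.of_bound hf2c.aestronglyMeasurable K2 (Eventually.of_forall fun b => hK2 b (Set.mem_univ _))
  -- the weight in the two normalisations
  have hw : ∀ c : RectSlice Ls (Matrix.specialUnitaryGroup (Fin 2) ℂ),
      (∏ e : RectTorusSite Ls × Fin k, Real.exp (J * (ρ (c e)).trace.re)) =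
        ∏ e : RectTorusSite Ls × Fin k, Real.exp (β * su2a0 (c e)) := fun c =>
    Finset.prod_congr rfl fun e _ => by rw [hρdef, su2_weight_eq, hJ]; ring_nf
  have hc0int : (∫ g, Real.exp (β * su2a0 g) ∂haarProbability (Matrix.specialUnitaryGroup (Fin 2) ℂ)) = c0 :=
    su2_integral_exp_su2a0_eq hβ.le
  -- gauge and twist invariance of `W2`
  have hW2g : ∀ (γ : RectTorusSite Ls → Matrix.specialUnitaryGroup (Fin 2) ℂ) (b : RectSlice Ls (Matrix.specialUnitaryGroup (Fin 2) ℂ)),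
      W2 (fun e => γ e.1 * b e * (γ (e.1 + Pi.single e.2 1))⁻¹) = W2 b := by
    intro γ b
    simp only [hW2, hℓ]
    rw [prod_ofFn_rectLine_gauge, mul_assoc, su2a0_mul_comm, inv_mul_cancel_right]
  have h1g : ∀ (γ : RectTorusSite Ls → Matrix.specialUnitaryGroup (Fin 2) ℂ) (b : RectSlice Ls (Matrix.specialUnitaryGroup (Fin 2) ℂ)),
      (fun _ : RectSlice Ls (Matrix.specialUnitaryGroup (Fin 2) ℂ) => (1 : ℝ))
        (fun e => γ e.1 * b e * (γ (e.1 + Pi.single e.2 1))⁻¹) = (fun _ => (1 : ℝ)) b := fun _ _ => rfl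
  have hW2s : ∀ (s : Fin k → ZMod 2) (b : RectSlice Ls (Matrix.specialUnitaryGroup (Fin 2) ℂ)),
      W2 (rectFluxTwist su2MinusOne s b) = W2 b := by
    intro s b
    simp only [hW2, hℓ]
    rw [prod_ofFn_rectLine_fluxTwist]
    split_ifs
    · exact chebyshevU_two_su2a0_su2MinusOne_mul _
    · rw [one_mul]
  -- reproducing properties
  have hrep2 : ∀ a : RectSlice Ls (Matrix.specialUnitaryGroup (Fin 2) ℂ),
      ∫ c, (∏ e : RectTorusSite Ls × Fin k, Real.exp (J * (ρ (c e)).trace.re)) * W2 (c * a)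
        ∂(rectSliceMeasure (Matrix.specialUnitaryGroup (Fin 2) ℂ) Ls) = C2 * W2 a := by
    intro a
    simp_rw [hw]
    have h4 : ∀ c : RectSlice Ls (Matrix.specialUnitaryGroup (Fin 2) ℂ), W2 (c * a) =
        (U ℝ ((2 : ℕ) : ℤ)).eval (su2a0 ((List.ofFn fun t : Fin (Ls μ) => c (ℓ t) * a (ℓ t)).prod)) := by
      intro c; simp only [hW2, Pi.mul_apply]
    simp_rw [h4]
    rw [su2_integral_prod_exp_mul_chebyshevU_rectLine hβ.le 2 ℓ (rectLine_injective μ) (fun t => a (ℓ t)), hc0int]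
  have hrep1 : ∀ a : RectSlice Ls (Matrix.specialUnitaryGroup (Fin 2) ℂ),
      ∫ c, (∏ e : RectTorusSite Ls × Fin k, Real.exp (J * (ρ (c e)).trace.re)) * (fun _ => (1 : ℝ)) (c * a)
        ∂(rectSliceMeasure (Matrix.specialUnitaryGroup (Fin 2) ℂ) Ls) = c0 ^ N * (fun _ => (1 : ℝ)) a := by
    intro a
    simp_rw [hw, mul_one]
    rw [show rectSliceMeasure (Matrix.specialUnitaryGroup (Fin 2) ℂ) Ls =
      Measure.pi (fun _ : RectTorusSite Ls × Fin k => haarProbability (Matrix.specialUnitaryGroup (Fin 2) ℂ)) from rfl,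
      integral_fintype_prod_eq_prod (fun (_ : RectTorusSite Ls × Fin k) (g : Matrix.specialUnitaryGroup (Fin 2) ℂ) =>
        Real.exp (β * su2a0 g)), Finset.prod_const, Finset.card_univ, hc0int]
  -- matrix elements
  have hA2 := inner_rectTubeTransferOperator_reproducingState_left ρ J (Ls := Ls) (continuous_fundamentalRep (Fin 2))
    hW2c hW2g hrep2 hmem2 hmem2
  have hA12 := inner_rectTubeTransferOperator_reproducingState_left ρ J (Ls := Ls) (continuous_fundamentalRep (Fin 2))
    hW2c hW2g hrep2 hmem1 hmem2
  -- `∫ W2 = 0` (the chain at `β = 0`)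
  have hW2int : ∫ b, (fun _ => (1 : ℝ)) b * W2 b ∂(rectSliceMeasure (Matrix.specialUnitaryGroup (Fin 2) ℂ) Ls) = 0 := by
    have h := su2_integral_prod_exp_mul_chebyshevU_rectLine (Ls := Ls) le_rfl 2 ℓ (rectLine_injective μ) (fun _ => 1)
    simp only [zero_mul, Real.exp_zero, Finset.prod_const_one, one_mul, mul_one] at h
    rw [besselISub_two_div_three_zero, zero_pow (NeZero.ne (Ls μ)), mul_zero, zero_mul] at h
    simp only [hW2, one_mul]
    exact h
  have hcross : @inner ℝ _ _ (hmem1.toLp _) (rectTubeTransferOperator ρ J Ls (hmem2.toLp _)) = 0 := by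
    rw [hA12, hW2int, mul_zero]
  -- positivity of the constants
  have hc0pos : 0 < c0 := by
    rw [← hc0int]
    exact integral_exp_pos ((Real.continuous_exp.comp (continuous_const.mul continuous_su2a0)).integrable_of_hasCompactSupport
      (HasCompactSupport.of_compactSpace _))
  have hq2pos : 0 < q2 := by
    rw [hq2, besselISub_div_succ hβ.ne' 2]
    exact div_pos (mul_pos two_pos (hIpos (2 + 1))) hβ
  have hC2pos : 0 < C2 := mul_pos (pow_pos hc0pos _) (pow_pos hq2pos _)
  -- the two states lie in the trivial-flux sector
  have hP01 : rectTubeFluxProjection su2MinusOne Ls 0 (hmem1.toLp _) = hmem1.toLp _ := by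
    have heig : ∀ s : Fin k → ZMod 2, rectFluxTwistOp Ls su2MinusOne s (hmem1.toLp _) = hmem1.toLp _ := by
      intro s
      have h := rectFluxTwistOp_toLp_eq_smul su2MinusOne s hmem1 1 fun b => by
        simp only [hm0]; rw [rectMagSum_fluxTwist ρ su2MinusOne_mem_center]; ring
      rwa [one_smul] at h
    rw [rectTubeFluxProjection_apply_of_invariant su2MinusOne heig, if_pos rfl]
  have hP02 : rectTubeFluxProjection su2MinusOne Ls 0 (hmem2.toLp _) = hmem2.toLp _ := by
    have heig : ∀ s : Fin k → ZMod 2, rectFluxTwistOp Ls su2MinusOne s (hmem2.toLp _) = hmem2.toLp _ := by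
      intro s
      have h := rectFluxTwistOp_toLp_eq_smul su2MinusOne s hmem2 1 fun b => by
        simp only [hm0]; rw [rectMagSum_fluxTwist ρ su2MinusOne_mem_center, hW2s]; ring
      rwa [one_smul] at h
    rw [rectTubeFluxProjection_apply_of_invariant su2MinusOne heig, if_pos rfl]
  have hφf1 : @inner ℝ _ _ φ₀ (hmem1.toLp _) ≠ 0 := by
    refine ne_of_gt ?_
    rw [inner_eq_integral]
    refine integral_pos_of_ae_pos (integrable_mul φ₀ (hmem1.toLp _)) ?_
    unfold IsStrictlyPositiveFun at hpos
    filter_upwards [hpos, hmem1.coeFn_toLp] with b hb h1b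
    rw [h1b]
    exact mul_pos hb (mul_pos (Real.exp_pos _) one_pos)
  -- the two diagonal matrix elements are positive
  have hA1pos : 0 < @inner ℝ _ _ (hmem1.toLp _) (rectTubeTransferOperator ρ J Ls (hmem1.toLp _)) := by
    have hA1 := inner_rectTubeTransferOperator_reproducingState_left ρ J (Ls := Ls) (continuous_fundamentalRep (Fin 2))
      continuous_const h1g hrep1 hmem1 hmem1
    rw [hA1]
    refine mul_pos (pow_pos hc0pos _) ?_
    have hint1 : ∫ b, (fun _ => (1 : ℝ)) b * (fun _ => (1 : ℝ)) b
        ∂(rectSliceMeasure (Matrix.specialUnitaryGroup (Fin 2) ℂ) Ls) = 1 := by simp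
    rw [hint1]; exact one_pos
  have hA2pos : 0 < @inner ℝ _ _ (hmem2.toLp _) (rectTubeTransferOperator ρ J Ls (hmem2.toLp _)) := by
    rw [hA2]
    refine mul_pos hC2pos ?_
    have h3 : W2 1 = 3 := by
      simp only [hW2, Pi.one_apply, List.ofFn_const, List.prod_replicate, one_pow]
      have : su2a0 (1 : Matrix.specialUnitaryGroup (Fin 2) ℂ) = 1 := by
        unfold su2a0; simp [Matrix.trace_one]
      rw [this]
      have h := U_eval_one (R := ℝ) ((2 : ℕ) : ℤ)
      push_cast at h ⊢
      linarith [h]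
    refine Continuous.integral_pos_of_hasCompactSupport_nonneg_nonzero (x := 1) (hW2c.mul hW2c)
      (HasCompactSupport.of_compactSpace _) (fun b => mul_self_nonneg _) ?_
    rw [h3]; norm_num
  -- the Rayleigh quotients and the two-state bound with `m = min`
  have hn1 : 0 < ‖hmem1.toLp _‖ := norm_pos_iff.2 fun h0 => hφf1 (by rw [h0, inner_zero_right])
  have hn2 : 0 < ‖hmem2.toLp _‖ := norm_pos_iff.2 fun h0 => hA2pos.ne' (by rw [h0, inner_zero_left])
  set r1 : ℝ := @inner ℝ _ _ (hmem1.toLp _) (rectTubeTransferOperator ρ J Ls (hmem1.toLp _)) / ‖hmem1.toLp _‖ ^ 2 with hr1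
  set r2 : ℝ := @inner ℝ _ _ (hmem2.toLp _) (rectTubeTransferOperator ρ J Ls (hmem2.toLp _)) / ‖hmem2.toLp _‖ ^ 2 with hr2
  have hr1pos : 0 < r1 := div_pos hA1pos (pow_pos hn1 2)
  have hr2pos : 0 < r2 := div_pos hA2pos (pow_pos hn2 2)
  have hmpos : 0 < min r1 r2 := lt_min hr1pos hr2pos
  have hA1' : min r1 r2 * ‖hmem1.toLp _‖ ^ 2 ≤ @inner ℝ _ _ (hmem1.toLp _) (rectTubeTransferOperator ρ J Ls (hmem1.toLp _)) :=
    calc min r1 r2 * ‖hmem1.toLp _‖ ^ 2 ≤ r1 * ‖hmem1.toLp _‖ ^ 2 :=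
          mul_le_mul_of_nonneg_right (min_le_left _ _) (sq_nonneg _)
      _ = _ := div_mul_cancel₀ _ (pow_pos hn1 2).ne'
  have hA2' : min r1 r2 * ‖hmem2.toLp _‖ ^ 2 ≤ @inner ℝ _ _ (hmem2.toLp _) (rectTubeTransferOperator ρ J Ls (hmem2.toLp _)) :=
    calc min r1 r2 * ‖hmem2.toLp _‖ ^ 2 ≤ r2 * ‖hmem2.toLp _‖ ^ 2 :=
          mul_le_mul_of_nonneg_right (min_le_right _ _) (sq_nonneg _)
      _ = _ := div_mul_cancel₀ _ (pow_pos hn2 2).ne'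
  have htwo := rectTubeExcitedNorm_ge_half_of_two_states ρ J (Ls := Ls) (continuous_fundamentalRep (Fin 2))
    fundamentalRep_mem_unitaryGroup hvac hP01 hP02 hφf1 hcross hmpos.le hA1' hA2' hA2pos
  unfold su2RectExcitedNorm
  exact lt_of_lt_of_le (half_pos hmpos) htwo

/-- **`m′ > 0` HYPOTHESIS-FREE**: on every rectangular `SU(2)` tube and every `β > 0`, `0 < su2RectMassGapPrime β Ls`
(the excited trivial-flux space is not annihilated, and Jentzsch's gap).  Requires `k ≥ 1` (an axis to wind along).
Finite volume only. [cite: ReedSimonIV1978, §XIII.12] -/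
theorem su2RectMassGapPrime_pos {β : ℝ} (hβ : 0 < β) (Ls : Fin k → ℕ) [∀ i, NeZero (Ls i)] (μ : Fin k) :
    0 < su2RectMassGapPrime β Ls := by
  haveI : SecondCountableTopology (Matrix.specialUnitaryGroup (Fin 2) ℂ) := secondCountableTopology_su2
  exact rectTubeMassGapPrime_pos (fundamentalRep (Fin 2)) (β / 2) (Ls := Ls) (continuous_fundamentalRep (Fin 2))
    fundamentalRep_mem_unitaryGroup su2MinusOne_mem_center su2MinusOne_mul_self (su2_rectExcitedNorm_pos hβ Ls μ)

end SU2

end Summit.Ventures.YMGap.FlowData
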